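import Summits.QuantumFields.BalabanUV.T4Continuum.Support.CTGaugeUnitFactorHbd
import Summits.QuantumFields.BalabanUV.T4Continuum.Support.CTVectorPropagator

/-!
# T⁴ programme, spine node NE2 (U1a), sub-row Δ3 «NE2-WALK» (T4-DAG `T4-U1a.S-NE2-D3-WALK°`) — AN ADMISSIBLE COMBES–THOMAS RATE
# `kappaCT(|o|, d, a, a′) > 0` FOR THE «Δ3-CT» CHAIN (the five `κ`-smallness binders of `balaban_final_decayStations_of_regular_smallField`
# DISCHARGED by continuity at `κ = 0` of the chain's closed-form constants)

NE2 formalisation swarm `b2b-balaban-t4-ne2-formalise-*`, leaf prover 06 (gen 4), supplier item «Δ3-CT-EXPLICIT» file 1 of 4 (successor items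
(i)+(ii) of gen 3's record; chain «Δ3-CT» p220700 … «Δ3-CT-HBD-B4-DIFF» p227253).  Gen 3's headline
`CTGaugeSlotDiff.balaban_final_decayStations_of_regular_smallField` displays, besides the END of record's binders, NINE numeric binders; five of
them concern the rate `κ` ALONE (at zero background):
  `Jfree d a″ κ 1 < γ′(a″)`, `deltaK d a″ κ 1 < σ₀(a″)²`, `JA d a a″ κ 1 < γ_D`, `0 < γ_U(0,0) − Jcov(0,0,κ)`, `deltaKU(0,0,κ) < σ₀(a′)²`.
Every left side is a CLOSED-FORM expression in `κ` built from `+ · ⁻¹ √ exp cosh |·|` (substrate `CTScalarGreen(Comm)` ∕ `CTGaugeTerm` ∕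
`CTVectorPropagator` ∕ `ScalarCovariantCoercive`, gen 3's `CTGaugeUnitFactorHbd`), VANISHES at `κ = 0`, and is CONTINUOUS at `κ = 0` (every inverse
taken is of a quantity positive at `κ = 0`).  THIS FILE proves exactly that and extracts the rate:
 * §1 values at `κ = 0`: `c1_zero`, `epsQ_zero`, `gw_zero`, `EdG_zero`, `EQG_zero`, `deltaK_zero`, `EXp_zero`, `EK_zero`, **`JA_zero`**, `Jcov_zero`,
   `cR_zero`, `gR_zero`, **`deltaKU_zero`** (`Jfree_zero` is the substrate's, BY NAME);
 * §2 continuity (Mathlib `fun_prop` over local hypotheses): generic composites `continuousAt_K1_comp` ∕ `continuousAt_K2_comp` (the substrate's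
   `CTWeightedEnergy.K1 ∕ K2` along maps continuous at a point where `γ ≠ 0`); everywhere-continuity `continuous_c1 ∕ continuous_epsQ ∕
   continuous_Jfree ∕ continuous_gw ∕ continuous_Jcov ∕ continuous_cR`; `gw_zero_ne`; continuity AT `κ = 0` `continuousAt_BdG ∕ continuousAt_EdG ∕
   continuousAt_EQG ∕ continuousAt_deltaK ∕ continuousAt_EXp ∕ continuousAt_EK`, **`continuousAt_JA`**, `continuousAt_gR`, **`continuousAt_deltaKU`**;
 * §3 COMPOSABLE WINDOWS at `𝓝 0` (consumers intersect with `.and`): `eventually_Jfree_lt`, `eventually_deltaK_lt`, **`eventually_JA_lt`** (ANY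
   right-hand side `γ > 0` — `gammaA d a` for the substrate's VEC-6, `gamD d a` here), `eventually_gammaU_sub_Jcov_pos`, `eventually_deltaKU_lt`,
   `exists_pos_le_one_of_eventually`; **`exists_admissibleRate`**: `∃ κ, 0 < κ ∧ κ ≤ 1 ∧` (the five inequalities); **`kappaCT co d a a′`** (`Classical.choose` at the canonical auxiliary mass `a″ = 1`; `1` off the domain `0 < a′`) with
   **`kappaCT_spec`** ∕ `kappaCT_pos` ∕ `kappaCT_le_one`.

HONEST FRAMING (T4-DAG p. 1).  Elementary real analysis over landed closed-form constants ([folklore]); `kappaCT` EXISTS as a definite function of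
`(|o|, d, a, a′)` but is NOT extracted in closed form (no number is claimed); statements and constants OURS; MODEL level (no B0); nothing printed
asserted; Δ3 NOT closed as a spine row; NE2 (U1a) NOT PROVED; spine PROVED 0/9 unchanged; NOT infinite volume, NOT a mass gap, NOT the Clay
problem, NOT summit progress.  HONEST DEPENDENCY: continuum YM on T⁴ ⇐ BetaPertH ∧ nine spine estimates (0/9 proved); BetaPertH ⇐ (D1) ∧ (D4) ∧
CAP+tail; G-an2-4 gates asym, D1 and NE2/3/4.  ABSOLUTE RULE kept; no `def … : Prop`; no `sorry`.
-/

noncomputable section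

open Filter Topology

namespace Summit.QuantumFields.BalabanUV.T4Continuum.CTAdmissibleRate

open Summit.QuantumFields.BalabanUV.T4Continuum
open Summit.QuantumFields.BalabanUV.T4Continuum.ScalarAveragedPropagator (gammaPs gammaPs_pos)
open Summit.QuantumFields.BalabanUV.T4Continuum.ScalarAveragedCompression (sigma0 sigma0_pos)
open Summit.QuantumFields.BalabanUV.T4Continuum.ScalarCovariantCoercive (gammaU Jcov)
open Summit.QuantumFields.BalabanUV.T4Continuum.DirichletRegionTower (gamD gamD_pos)
open Summit.QuantumFields.BalabanUV.T4Continuum.CTWeightedEnergy (K1 K2)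
open Summit.QuantumFields.BalabanUV.T4Continuum.CTScalarGreen (Jfree Jfree_zero c1)
open Summit.QuantumFields.BalabanUV.T4Continuum.CTScalarGreenComm (gw BdG epsQ EdG EQG)
open Summit.QuantumFields.BalabanUV.T4Continuum.CTGaugeTerm (BXp EXp deltaK EK)
open Summit.QuantumFields.BalabanUV.T4Continuum.CTVectorPropagator (JA)
open Summit.QuantumFields.BalabanUV.T4Continuum.CTCovariantScalarGreen (cR)
open Summit.QuantumFields.BalabanUV.T4Continuum.CTGaugeUnitFactorHbd (gR deltaKU)

variable {d : ℕ}

/-! ## §1 Values at `κ = 0` -/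

section Zero

variable (d)

/-- `c₁(0) = 0`. [folklore] -/
theorem c1_zero : c1 d 0 = 0 := by simp [c1]

/-- `ε_Q(0, Λ) = 0`. [folklore] -/
theorem epsQ_zero (Λ : ℝ) : epsQ 0 Λ = 0 := by simp [epsQ]

/-- `γw(0) = γ′`. [folklore] -/
theorem gw_zero (a' Λ : ℝ) : gw d a' 0 Λ = gammaPs d a' := by simp [gw, Jfree_zero]

/-- `EdG(0) = 0`. [folklore] -/
theorem EdG_zero (a' Λ : ℝ) : EdG d a' 0 Λ = 0 := by simp [EdG, c1_zero, epsQ_zero]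

/-- `EQG(0) = 0`. [folklore] -/
theorem EQG_zero (a' Λ : ℝ) : EQG d a' 0 Λ = 0 := by simp [EQG, c1_zero, epsQ_zero]

/-- `deltaK(0) = 0`. [folklore] -/
theorem deltaK_zero (a' Λ : ℝ) : deltaK d a' 0 Λ = 0 := by simp [deltaK, EQG_zero]

/-- `EXp(0) = 0`. [folklore] -/
theorem EXp_zero (a' Λ : ℝ) : EXp d a' 0 Λ = 0 := by simp [EXp, EdG_zero, epsQ_zero]

/-- `EK(0) = 0`. [folklore] -/
theorem EK_zero (a' Λ : ℝ) : EK d a' 0 Λ = 0 := by simp [EK, EXp_zero, deltaK_zero]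

/-- **`JA(0) = 0`**: the conjugation-defect budget of `Δ_a` vanishes at rate `0`. [folklore] -/
theorem JA_zero (a a' Λ : ℝ) : JA d a a' 0 Λ = 0 := by simp [JA, EK_zero]

/-- `Jcov(α, τ, 0) = 0`. [folklore] -/
theorem Jcov_zero (co : ℕ) (a' α τ : ℝ) : Jcov co d a' α τ 0 = 0 := by simp [Jcov]

/-- `cR(α, 0) = 0`. [folklore] -/
theorem cR_zero (α : ℝ) : cR d α 0 = 0 := by simp [cR]

/-- `gR(α, τ, 0) = 0`. [folklore] -/
theorem gR_zero (co : ℕ) (a' α τ : ℝ) : gR co d a' α τ 0 = 0 := by simp [gR, cR_zero]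

/-- **`deltaKU(α, τ, 0) = 0`**: the conjugation error of the unit-layer Gram operator vanishes at rate `0`. [folklore] -/
theorem deltaKU_zero (co : ℕ) (a' α τ : ℝ) : deltaKU co d a' α τ 0 = 0 := by simp [deltaKU, gR_zero]

end Zero

/-! ## §2 Continuity at `κ = 0` -/

section Continuity

/-- `K₁(f, g, h)` is continuous at a point where `f ≠ 0`, along maps continuous there. [folklore] -/
theorem continuousAt_K1_comp {f g h : ℝ → ℝ} {x : ℝ} (hf : ContinuousAt f x) (hg : ContinuousAt g x) (hh : ContinuousAt h x)
    (h0 : f x ≠ 0) : ContinuousAt (fun y => K1 (f y) (g y) (h y)) x := by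
  have h0' : f x ^ 2 ≠ 0 := pow_ne_zero 2 h0
  unfold K1
  fun_prop (disch := assumption)

/-- `K₂(f, g, h)` is continuous at a point where `f ≠ 0`, along maps continuous there. [folklore] -/
theorem continuousAt_K2_comp {f g h : ℝ → ℝ} {x : ℝ} (hf : ContinuousAt f x) (hg : ContinuousAt g x) (hh : ContinuousAt h x)
    (h0 : f x ≠ 0) : ContinuousAt (fun y => K2 (f y) (g y) (h y)) x := by
  have h0' : f x ^ 2 ≠ 0 := pow_ne_zero 2 h0
  have hK1 := continuousAt_K1_comp hf hg hh h0
  unfold K2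
  fun_prop (disch := assumption)

variable (d)

/-- `κ ↦ c₁(κ)` is continuous. [folklore] -/
theorem continuous_c1 : Continuous (fun κ : ℝ => c1 d κ) := by unfold c1; fun_prop

/-- `κ ↦ ε_Q(κ, Λ)` is continuous. [folklore] -/
theorem continuous_epsQ (Λ : ℝ) : Continuous (fun κ : ℝ => epsQ κ Λ) := by unfold epsQ; fun_prop

/-- `κ ↦ Jfree(κ)` is continuous. [folklore] -/
theorem continuous_Jfree (a' Λ : ℝ) : Continuous (fun κ : ℝ => Jfree d a' κ Λ) := by unfold Jfree; fun_prop

/-- `κ ↦ γw(κ)` is continuous. [folklore] -/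
theorem continuous_gw (a' Λ : ℝ) : Continuous (fun κ : ℝ => gw d a' κ Λ) := by
  have := continuous_Jfree d a' Λ
  unfold gw; fun_prop

/-- `γw(0) ≠ 0`. [folklore] -/
theorem gw_zero_ne (a' Λ : ℝ) : gw d a' 0 Λ ≠ 0 := by rw [gw_zero]; exact (gammaPs_pos (d := d) (a' := a')).1.ne'

/-- `κ ↦ B_∂(κ)` is continuous at `0`. [folklore] -/
theorem continuousAt_BdG (a' Λ : ℝ) : ContinuousAt (fun κ : ℝ => BdG d a' κ Λ) 0 := by
  have h1 := (continuous_gw d a' Λ).continuousAt (x := (0 : ℝ))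
  have h2 := (continuous_Jfree d a' Λ).continuousAt (x := (0 : ℝ))
  have h0 := gw_zero_ne d a' Λ
  have h0' : gw d a' 0 Λ ^ 2 ≠ 0 := pow_ne_zero 2 h0
  unfold BdG
  fun_prop (disch := assumption)

/-- `κ ↦ EdG(κ)` is continuous at `0`. [folklore] -/
theorem continuousAt_EdG (a' Λ : ℝ) : ContinuousAt (fun κ : ℝ => EdG d a' κ Λ) 0 := by
  have h1 := (continuous_gw d a' Λ).continuousAt (x := (0 : ℝ))
  have h2 := (continuous_Jfree d a' Λ).continuousAt (x := (0 : ℝ))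
  have h3 := (continuous_c1 d).continuousAt (x := (0 : ℝ))
  have h4 := (continuous_epsQ Λ).continuousAt (x := (0 : ℝ))
  have h5 := continuousAt_BdG d a' Λ
  have h0 := gw_zero_ne d a' Λ
  have h6 : ContinuousAt (fun κ : ℝ => K1 (gw d a' κ Λ) (Jfree d a' κ Λ) (c1 d κ)) 0 := continuousAt_K1_comp h1 h2 h3 h0
  unfold EdG
  fun_prop (disch := assumption)

/-- `κ ↦ EQG(κ)` is continuous at `0`. [folklore] -/
theorem continuousAt_EQG (a' Λ : ℝ) : ContinuousAt (fun κ : ℝ => EQG d a' κ Λ) 0 := by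
  have h1 := (continuous_gw d a' Λ).continuousAt (x := (0 : ℝ))
  have h2 := (continuous_Jfree d a' Λ).continuousAt (x := (0 : ℝ))
  have h3 := (continuous_c1 d).continuousAt (x := (0 : ℝ))
  have h4 := (continuous_epsQ Λ).continuousAt (x := (0 : ℝ))
  have h0 := gw_zero_ne d a' Λ
  have h6 : ContinuousAt (fun κ : ℝ => K2 (gw d a' κ Λ) (Jfree d a' κ Λ) (c1 d κ)) 0 := continuousAt_K2_comp h1 h2 h3 h0
  unfold EQG
  fun_prop (disch := assumption)

/-- `κ ↦ deltaK(κ)` is continuous at `0`. [folklore] -/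
theorem continuousAt_deltaK (a' Λ : ℝ) : ContinuousAt (fun κ : ℝ => deltaK d a' κ Λ) 0 := by
  have h1 := continuousAt_EQG d a' Λ
  unfold deltaK
  fun_prop

/-- `κ ↦ EXp(κ)` is continuous at `0`. [folklore] -/
theorem continuousAt_EXp (a' Λ : ℝ) : ContinuousAt (fun κ : ℝ => EXp d a' κ Λ) 0 := by
  have h1 := continuousAt_EdG d a' Λ
  have h2 := (continuous_epsQ Λ).continuousAt (x := (0 : ℝ))
  unfold EXp
  fun_prop

/-- `κ ↦ EK(κ)` is continuous at `0` (`a′ > 0`: the inverse `(σ₀² − deltaK)⁻¹` is taken at `σ₀² > 0`). [folklore] -/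
theorem continuousAt_EK {a' : ℝ} (ha' : 0 < a') (Λ : ℝ) : ContinuousAt (fun κ : ℝ => EK d a' κ Λ) 0 := by
  have h1 := continuousAt_EXp d a' Λ
  have h2 := continuousAt_deltaK d a' Λ
  have hσ := sigma0_pos (d := d) ha'
  have h0 : sigma0 d a' ^ 2 - deltaK d a' 0 Λ ≠ 0 := by rw [deltaK_zero, sub_zero]; positivity
  unfold EK
  fun_prop (disch := assumption)

/-- **`κ ↦ JA(κ)` is continuous at `0`** (`a′ > 0`). [folklore] -/
theorem continuousAt_JA (a : ℝ) {a' : ℝ} (ha' : 0 < a') (Λ : ℝ) : ContinuousAt (fun κ : ℝ => JA d a a' κ Λ) 0 := by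
  have h1 := continuousAt_EK d ha' Λ
  unfold JA
  fun_prop

/-- `κ ↦ Jcov(α, τ, κ)` is continuous. [folklore] -/
theorem continuous_Jcov (co : ℕ) (a' α τ : ℝ) : Continuous (fun κ : ℝ => Jcov co d a' α τ κ) := by unfold Jcov; fun_prop

/-- `κ ↦ cR(α, κ)` is continuous. [folklore] -/
theorem continuous_cR (α : ℝ) : Continuous (fun κ : ℝ => cR d α κ) := by unfold cR; fun_prop

/-- `κ ↦ gR(α, τ, κ)` is continuous at `0` whenever `γ_U(α, τ) > 0`. [folklore] -/
theorem continuousAt_gR (co : ℕ) {a' α τ : ℝ} (hγU : 0 < gammaU d a' α τ) : ContinuousAt (fun κ : ℝ => gR co d a' α τ κ) 0 := by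
  have h1 := (continuous_Jcov d co a' α τ).continuousAt (x := (0 : ℝ))
  have h2 := (continuous_cR d α).continuousAt (x := (0 : ℝ))
  have h3 : ContinuousAt (fun κ : ℝ => gammaU d a' α τ - Jcov co d a' α τ κ) 0 := by fun_prop
  have h0 : gammaU d a' α τ - Jcov co d a' α τ 0 ≠ 0 := by rw [Jcov_zero, sub_zero]; exact hγU.ne'
  have h4 : ContinuousAt (fun κ : ℝ => K2 (gammaU d a' α τ - Jcov co d a' α τ κ) (Jcov co d a' α τ κ) (cR d α κ)) 0 :=
    continuousAt_K2_comp h3 h1 h2 h0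
  unfold gR
  fun_prop (disch := assumption)

/-- **`κ ↦ deltaKU(α, τ, κ)` is continuous at `0`** whenever `γ_U(α, τ) > 0`. [folklore] -/
theorem continuousAt_deltaKU (co : ℕ) {a' α τ : ℝ} (hγU : 0 < gammaU d a' α τ) :
    ContinuousAt (fun κ : ℝ => deltaKU co d a' α τ κ) 0 := by
  have h1 := (continuous_Jcov d co a' α τ).continuousAt (x := (0 : ℝ))
  have h2 := continuousAt_gR d co hγU
  have h0 : gammaU d a' α τ - Jcov co d a' α τ 0 ≠ 0 := by rw [Jcov_zero, sub_zero]; exact hγU.ne'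
  unfold deltaKU
  fun_prop (disch := assumption)

end Continuity

/-! ## §3 The admissible rate -/

section Rate

/-- extraction of a positive witness `κ ∈ (0, 1]` from an eventual statement at `𝓝 0` (the composable form consumers intersect with `.and`).
[folklore] -/
theorem exists_pos_le_one_of_eventually {p : ℝ → Prop} (h : ∀ᶠ κ : ℝ in 𝓝 0, p κ) : ∃ κ : ℝ, 0 < κ ∧ κ ≤ 1 ∧ p κ := by
  obtain ⟨ε, hε, hball⟩ := Metric.eventually_nhds_iff.mp h
  refine ⟨min (ε / 2) 1, lt_min (half_pos hε) one_pos, min_le_right _ _, hball ?_⟩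
  rw [Real.dist_eq, sub_zero, abs_of_pos (lt_min (half_pos hε) one_pos)]
  exact lt_of_le_of_lt (min_le_left _ _) (half_lt_self hε)

/-- WINDOW `Jfree < γ′` for all `κ` near `0`. [folklore] -/
theorem eventually_Jfree_lt (d : ℕ) (a' Λ : ℝ) : ∀ᶠ κ : ℝ in 𝓝 0, Jfree d a' κ Λ < gammaPs d a' :=
  ((continuous_Jfree d a' Λ).continuousAt (x := (0 : ℝ))).eventually_lt continuousAt_const
    (by rw [Jfree_zero]; exact (gammaPs_pos (d := d) (a' := a')).1)

/-- WINDOW `CTGaugeTerm.deltaK < σ₀²` for all `κ` near `0` (`a′ > 0`). [folklore] -/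
theorem eventually_deltaK_lt (d : ℕ) {a' : ℝ} (ha' : 0 < a') (Λ : ℝ) : ∀ᶠ κ : ℝ in 𝓝 0, deltaK d a' κ Λ < sigma0 d a' ^ 2 := by
  have hσ := sigma0_pos (d := d) ha'
  exact (continuousAt_deltaK d a' Λ).eventually_lt continuousAt_const (by rw [deltaK_zero]; positivity)

/-- **WINDOW `JA < γ` for all `κ` near `0`, for ANY positive right-hand side** (`γ = gammaA d a` for the substrate's VEC-6, `γ = gamD d a` for
NE2's Δ3). [folklore] -/
theorem eventually_JA_lt (d : ℕ) (a : ℝ) {a' : ℝ} (ha' : 0 < a') (Λ : ℝ) {γ : ℝ} (hγ : 0 < γ) : ∀ᶠ κ : ℝ in 𝓝 0, JA d a a' κ Λ < γ :=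
  (continuousAt_JA d a ha' Λ).eventually_lt continuousAt_const (by rw [JA_zero]; exact hγ)

/-- WINDOW `0 < γ_U(α,τ) − Jcov(α,τ,κ)` for all `κ` near `0`, whenever `γ_U(α,τ) > 0` (NE2's `hγ ∕ hγ1` shape). [folklore] -/
theorem eventually_gammaU_sub_Jcov_pos (d co : ℕ) {a' α τ : ℝ} (hγU : 0 < gammaU d a' α τ) :
    ∀ᶠ κ : ℝ in 𝓝 0, 0 < gammaU d a' α τ - Jcov co d a' α τ κ := by
  have hc : ContinuousAt (fun κ : ℝ => gammaU d a' α τ - Jcov co d a' α τ κ) 0 := by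
    have := (continuous_Jcov d co a' α τ).continuousAt (x := (0 : ℝ)); fun_prop
  exact continuousAt_const.eventually_lt hc (by rw [Jcov_zero, sub_zero]; exact hγU)

/-- WINDOW `deltaKU(α,τ,κ) < s` for all `κ` near `0`, for any `s > 0`, whenever `γ_U(α,τ) > 0` (NE2's `hδU ∕ hδ1` shape). [folklore] -/
theorem eventually_deltaKU_lt (d co : ℕ) {a' α τ : ℝ} (hγU : 0 < gammaU d a' α τ) {s : ℝ} (hs : 0 < s) :
    ∀ᶠ κ : ℝ in 𝓝 0, deltaKU co d a' α τ κ < s :=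
  (continuousAt_deltaKU d co hγU).eventually_lt continuousAt_const (by rw [deltaKU_zero]; exact hs)

/-- **AN ADMISSIBLE RATE EXISTS**: for `a′, a″ > 0` there is `κ ∈ (0, 1]` satisfying the five `κ`-smallness binders of
`CTGaugeSlotDiff.balaban_final_decayStations_of_regular_smallField` (the three of the `U = 1` core at the auxiliary mass `a″`, the two of the
unit-layer factor at `a′` and zero background) — by continuity at `κ = 0`, where all five left sides vanish. [folklore] -/
theorem exists_admissibleRate (d co : ℕ) (a : ℝ) {a' a'' : ℝ} (ha' : 0 < a') (ha'' : 0 < a'') :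
    ∃ κ : ℝ, 0 < κ ∧ κ ≤ 1 ∧ Jfree d a'' κ 1 < gammaPs d a'' ∧ deltaK d a'' κ 1 < sigma0 d a'' ^ 2 ∧ JA d a a'' κ 1 < gamD d a ∧
      0 < gammaU d a' 0 0 - Jcov co d a' 0 0 κ ∧ deltaKU co d a' 0 0 κ < sigma0 d a' ^ 2 := by
  have hγU : 0 < gammaU d a' 0 0 := by
    rw [show gammaU d a' 0 0 = gammaPs d a' / 2 by simp [gammaU]]  -- (= the substrate's `ScalarCovariantGreenOfField.gammaU_zero`)
    exact half_pos (gammaPs_pos (d := d) (a' := a')).1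
  have hσ' := sigma0_pos (d := d) ha'
  have e5 : ∀ᶠ κ : ℝ in 𝓝 0, deltaKU co d a' 0 0 κ < sigma0 d a' ^ 2 := eventually_deltaKU_lt d co hγU (by positivity)
  exact exists_pos_le_one_of_eventually ((eventually_Jfree_lt d a'' 1).and ((eventually_deltaK_lt d ha'' 1).and
    ((eventually_JA_lt d a ha'' 1 (gamD_pos (d := d) a)).and ((eventually_gammaU_sub_Jcov_pos d co hγU).and e5))))

/-- **THE ADMISSIBLE COMBES–THOMAS RATE `kappaCT(|o|, d, a, a′)`** of the «Δ3-CT» chain at the canonical auxiliary mass `a″ = 1` (a definite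
function of its arguments by `Classical.choose`; `1` off the domain `0 < a′`; NOT a closed form). [folklore] -/
def kappaCT (co d : ℕ) (a a' : ℝ) : ℝ :=
  if h : 0 < a' then Classical.choose (exists_admissibleRate d co a h one_pos) else 1

/-- **THE FIVE `κ`-SMALLNESS BINDERS HOLD AT `kappaCT`** (`a″ = 1`), and `0 < kappaCT ≤ 1`. [folklore] -/
theorem kappaCT_spec (co d : ℕ) (a : ℝ) {a' : ℝ} (ha' : 0 < a') :
    0 < kappaCT co d a a' ∧ kappaCT co d a a' ≤ 1 ∧ Jfree d 1 (kappaCT co d a a') 1 < gammaPs d 1 ∧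
      deltaK d 1 (kappaCT co d a a') 1 < sigma0 d 1 ^ 2 ∧ JA d a 1 (kappaCT co d a a') 1 < gamD d a ∧
      0 < gammaU d a' 0 0 - Jcov co d a' 0 0 (kappaCT co d a a') ∧ deltaKU co d a' 0 0 (kappaCT co d a a') < sigma0 d a' ^ 2 := by
  rw [kappaCT, dif_pos ha']
  exact Classical.choose_spec (exists_admissibleRate d co a ha' one_pos)

/-- `0 < kappaCT`. [folklore] -/
theorem kappaCT_pos (co d : ℕ) (a : ℝ) {a' : ℝ} (ha' : 0 < a') : 0 < kappaCT co d a a' := (kappaCT_spec co d a ha').1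

/-- `kappaCT ≤ 1`. [folklore] -/
theorem kappaCT_le_one (co d : ℕ) (a : ℝ) {a' : ℝ} (ha' : 0 < a') : kappaCT co d a a' ≤ 1 := (kappaCT_spec co d a ha').2.1

end Rate

end Summit.QuantumFields.BalabanUV.T4Continuum.CTAdmissibleRate

end
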